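import Literature.Analysis.FluidPDE.FracNSPotentialForcing
import HarnessLib

/-!
# De Rosa's gluing stage, Prop. 5.4: the bounds (5.23), (5.25′) for the vector potential

L. De Rosa, *Infinitely many Leray–Hopf solutions for the fractional Navier–Stokes equations*,
Comm. PDE 44 (2019) 335–365 = arXiv:1801.10235, §5.2, Prop. 5.4: "For `0 ≤ t - tᵢ ≤ 2τ_q`, `N ≥ 0`,
(5.23) `‖z̃ᵢ‖_{N+α} ≲ τ_qδ_{q+1}ℓ^{-N+α}`, (5.25′) `‖(∂ₜ + v_ℓ·∇ + ν(-Δ)^γ)z̃ᵢ‖_{N+α} ≲ δ_{q+1}ℓ^{-N+α}`",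
`z̃ᵢ = ℬ(vᵢ - v_ℓ)`; proof (p. 13): the equation of `z̃ᵢ` ((5.27), `DeRosa.fracPotential_transport_eq`),
the forcing bound (5.28) (`BDSV.holderCZBound.fracPotential_rhs_le`), "Thus, by (3.6) and Grönwall
inequality, we obtain (5.29) `‖z̃ᵢ‖_{N+α} ≲ τ_qδ_{q+1}ℓ^{-N+α} + ∫ (‖v‖_{N+1+α}‖z̃ᵢ‖_α + …)`. Fix
`N = 0` to get `‖z̃ᵢ‖_α ≲ τ_qδ_{q+1}ℓ^α`. Then we use it for the case `N ≥ 1` to conclude (5.23).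
Finally (5.25′) … is an obvious consequence of (5.28)".

This file proves the dimensionless form (twin of `DeRosa.fracStability`, `FracNSStability.lean`),
with the Calderón–Zygmund input `BDSV.holderCZBound` discharged by `BDSV.holderCZBound_holds`:

* `DeRosa.fracPotential_transport_eq'` — the equation of `z̃ = ℬ(vᵢ - v_ℓ)` with `w = curl z̃`
  substituted;
* `DeRosa.fracPotential_level` — level `N` given the levels `< N` (transport–diffusion estimate
  `Torus.eContDiffHolderNorm_fracTransport_higher`, forcing bound, absorption under the CFL
  smallness `(b-a)U ≤ c`);
* `DeRosa.fracPotential_zbound` — **(5.23), all levels `≤ N̄`**: `‖z̃(s)‖_{N,α} ≤ C (b-a) E Λ^N`;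
* `DeRosa.fracPotential_transport_le` — **(5.25′)**: `‖(∂ₜ + v_ℓ·∇ + ν(-Δ)^γ)z̃(s)‖_{N,α} ≤ C E Λ^N`;
* `DeRosa.fracPotentialStability` — both, uniformly in `N ≤ N̄`.

Here `‖v_ℓ(s)‖_{m,α}, ‖vᵢ(s)‖_{m,α} ≤ UΛ^{m-1}` (`1 ≤ m ≤ N̄+1`), `‖R̊_ℓ(s)‖_{m,α} ≤ EΛ^m` (`m ≤ N̄`);
with `b - a ≤ 2τ_q`, `Λ = ℓ⁻¹`, `E ≂ δ_{q+1}ℓ^α`, `U ≂ δ_q^{1/2}λ_qℓ^{-α}` these are (5.23), (5.25′).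

## References

* L. De Rosa, Comm. PDE 44 (2019) = arXiv:1801.10235, §5.2 Prop. 5.4 and its proof
  ((5.22)–(5.29)). [`Derosa2018`]
* T. Buckmaster, C. De Lellis, L. Székelyhidi Jr., V. Vicol, CPAM 72 (2019) = arXiv:1701.08678,
  Prop. 3.4 and §3.3. [`BuckmasterEtAl2018`]
-/

noncomputable section

open MeasureTheory Set Filter Function
open scoped NNReal ENNReal ContDiff

namespace Literature.Analysis.FluidPDE

namespace DeRosa

open FunctionSpaces FunctionSpaces.Torus
open BDSV hiding IsGlueFamily

variable {a b γ ν : ℝ} {vℓ v Z : ℝ → UnitAddTorus (Fin 3) → EuclideanSpace ℝ (Fin 3)}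
  {pℓ p : ℝ → UnitAddTorus (Fin 3) → ℝ} {Rℓ : ℝ → UnitAddTorus (Fin 3) → Fin 3 → EuclideanSpace ℝ (Fin 3)}

/-- **The equation of `z̃ = ℬ(vᵢ - v_ℓ)` with `w = curl z̃`**:
`∂ₜz̃ + (v_ℓ·∇)z̃ + ν(-Δ)^γ z̃ = -ℬ((curl z̃·∇)vᵢ) - ℬ(div R̊_ℓ) + ℬ(curl((v_ℓ·∇)z̃) - (v_ℓ·∇)curl z̃) + ∇Δ⁻¹div((z̃·∇)v_ℓ)`.
[cite: Derosa2018, §5.2 proof of Prop. 5.4 ((5.27))] -/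
theorem fracPotential_transport_eq' (hab : a < b) (hγ : 0 < γ) (hℓ : Torus.IsFracNSReynoldsOn (Icc a b) γ ν vℓ pℓ Rℓ)
    (hv : Torus.IsFracNSReynoldsOn (Icc a b) γ ν v p (fun _ _ _ => 0)) (hanchor : v a = vℓ a)
    (hZdef : ∀ t, Z t = BDSV.biotSavart (fun y => v t y - vℓ t y)) {s : ℝ} (hs : s ∈ Icc a b) (x : UnitAddTorus (Fin 3)) :
    FunctionSpaces.Torus.timeDerivWithin (Icc a b) Z s x + FunctionSpaces.Torus.convect (vℓ s) (Z s) x + ν • Torus.fracLaplacian γ (Z s) x =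
      -(BDSV.biotSavart (FunctionSpaces.Torus.convect (BDSV.curl (Z s)) (v s)) x) - BDSV.biotSavart (Torus.tensorDivergence (Rℓ s)) x +
        BDSV.biotSavart (fun y => BDSV.curl (FunctionSpaces.Torus.convect (vℓ s) (Z s)) y - FunctionSpaces.Torus.convect (vℓ s) (BDSV.curl (Z s)) y) x +
        Torus.gradient (FunctionSpaces.Torus.invLaplacian (FunctionSpaces.Torus.divergence (FunctionSpaces.Torus.convect (Z s) (vℓ s)))) x := by
  have hwdef : ∀ t y, (fun t y => v t y - vℓ t y) t y = v t y - vℓ t y := fun t y => rfl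
  have hZdef' : ∀ t, Z t = BDSV.biotSavart ((fun t y => v t y - vℓ t y) t) := fun t => hZdef t
  have h := fracPotential_transport_eq hab hγ hℓ hv hanchor hwdef hZdef' hs x
  have hcurl : BDSV.curl (Z s) = fun y => v s y - vℓ s y := fracPotential_curl_eq hγ hℓ hv hanchor hwdef hZdef' hs
  rw [← hcurl] at h
  exact h

/-- `z̃ = ℬ(vᵢ - v_ℓ)` is jointly smooth. [folklore] -/
theorem fracPotential_smooth_Z' (hab : a < b) (hℓ : Torus.IsFracNSReynoldsOn (Icc a b) γ ν vℓ pℓ Rℓ)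
    (hv : Torus.IsFracNSReynoldsOn (Icc a b) γ ν v p (fun _ _ _ => 0))
    (hZdef : ∀ t, Z t = BDSV.biotSavart (fun y => v t y - vℓ t y)) : FunctionSpaces.Torus.IsSmoothSpaceTimeOn (Icc a b) Z :=
  fracPotential_smooth_Z hab hℓ hv (w := fun t y => v t y - vℓ t y) (fun _ _ => rfl) hZdef

/-- The right-hand side of the potential equation is jointly smooth. [folklore] -/
theorem fracPotential_smooth_rhs (hab : a < b) (hℓ : Torus.IsFracNSReynoldsOn (Icc a b) γ ν vℓ pℓ Rℓ)
    (hv : Torus.IsFracNSReynoldsOn (Icc a b) γ ν v p (fun _ _ _ => 0))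
    (hZdef : ∀ t, Z t = BDSV.biotSavart (fun y => v t y - vℓ t y)) :
    FunctionSpaces.Torus.IsSmoothSpaceTimeOn (Icc a b) (fun s x =>
      -(BDSV.biotSavart (FunctionSpaces.Torus.convect (BDSV.curl (Z s)) (v s)) x) - BDSV.biotSavart (Torus.tensorDivergence (Rℓ s)) x +
        BDSV.biotSavart (fun y => BDSV.curl (FunctionSpaces.Torus.convect (vℓ s) (Z s)) y - FunctionSpaces.Torus.convect (vℓ s) (BDSV.curl (Z s)) y) x +
        Torus.gradient (FunctionSpaces.Torus.invLaplacian (FunctionSpaces.Torus.divergence (FunctionSpaces.Torus.convect (Z s) (vℓ s)))) x) := by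
  have hU : UniqueDiffOn ℝ (Icc a b) := uniqueDiffOn_Icc hab
  have hint : (interior (Icc a b)).Nonempty := by rw [interior_Icc]; exact nonempty_Ioo.2 hab
  have hZs : FunctionSpaces.Torus.IsSmoothSpaceTimeOn (Icc a b) Z := fracPotential_smooth_Z' hab hℓ hv hZdef
  have hcZ : FunctionSpaces.Torus.IsSmoothSpaceTimeOn (Icc a b) (fun t => BDSV.curl (Z t)) := isSmoothSpaceTimeOn_curl hZs hU
  have h1 : FunctionSpaces.Torus.IsSmoothSpaceTimeOn (Icc a b) (fun t => BDSV.biotSavart (FunctionSpaces.Torus.convect (BDSV.curl (Z t)) (v t))) :=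
    isSmoothSpaceTimeOn_biotSavart (hcZ.convect hv.smooth_velocity hU) (convex_Icc a b) hint
  have hRdiv : FunctionSpaces.Torus.IsSmoothSpaceTimeOn (Icc a b) (fun t => Torus.tensorDivergence (Rℓ t)) :=
    FunctionSpaces.Torus.IsSmoothSpaceTimeOn.sum fun j _ =>
      (hℓ.smooth_stress.clm_comp (ContinuousLinearMap.proj (R := ℝ)
        (φ := fun _ : Fin 3 => EuclideanSpace ℝ (Fin 3)) j)).partialDeriv hU j
  have h2 : FunctionSpaces.Torus.IsSmoothSpaceTimeOn (Icc a b) (fun t => BDSV.biotSavart (Torus.tensorDivergence (Rℓ t))) :=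
    isSmoothSpaceTimeOn_biotSavart hRdiv (convex_Icc a b) hint
  have h3a : FunctionSpaces.Torus.IsSmoothSpaceTimeOn (Icc a b) (fun t => BDSV.curl (FunctionSpaces.Torus.convect (vℓ t) (Z t))) :=
    isSmoothSpaceTimeOn_curl (hℓ.smooth_velocity.convect hZs hU) hU
  have h3b : FunctionSpaces.Torus.IsSmoothSpaceTimeOn (Icc a b) (fun t => FunctionSpaces.Torus.convect (vℓ t) (BDSV.curl (Z t))) :=
    hℓ.smooth_velocity.convect hcZ hU
  have h3 : FunctionSpaces.Torus.IsSmoothSpaceTimeOn (Icc a b) (fun t => BDSV.biotSavart (fun y =>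
      BDSV.curl (FunctionSpaces.Torus.convect (vℓ t) (Z t)) y - FunctionSpaces.Torus.convect (vℓ t) (BDSV.curl (Z t)) y)) :=
    isSmoothSpaceTimeOn_biotSavart (h3a.sub h3b) (convex_Icc a b) hint
  have h4 : FunctionSpaces.Torus.IsSmoothSpaceTimeOn (Icc a b) (fun t => Torus.gradient (FunctionSpaces.Torus.invLaplacian
      (FunctionSpaces.Torus.divergence (FunctionSpaces.Torus.convect (Z t) (vℓ t))))) :=
    (((hZs.convect hℓ.smooth_velocity hU).divergence hU).invLaplacian (convex_Icc a b) hint).gradient hU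
  exact ((h1.neg.sub h2).add h3).add h4

/-! ## Prop. 5.4, level `N` given the lower levels -/

section Level

/-- **Prop. 5.4 (5.23), level `N`, given the lower levels** ("by (3.6) and Grönwall … Fix `N = 0` …
Then we use it for the case `N ≥ 1`"): for `0 < α < 1`, `N` and a constant `CΦ` for the levels `< N`,
there are `c > 0`, `C ≥ 0` such that for `(v_ℓ, p_ℓ, R̊_ℓ)` fractional Navier–Stokes–Reynolds and
`(vᵢ, pᵢ)` exact fractional Navier–Stokes (`ν ≥ 0`, `0 < γ < 1`) on `[a,b] × T³` with `vᵢ(a) = v_ℓ(a)`,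
`‖v_ℓ(s)‖_{m,α}, ‖vᵢ(s)‖_{m,α} ≤ U Λ^{m-1}` (`1 ≤ m ≤ N+1`), `‖R̊_ℓ(s)‖_{N,α} ≤ E Λ^N`,
`‖z̃(s)‖_{m,α} ≤ CΦ (b-a) E Λ^m` (`m < N`) and `(b-a)U ≤ c`: `‖z̃(s)‖_{N,α} ≤ C (b-a) E Λ^N` on `[a,b]`,
`z̃ = ℬ(vᵢ - v_ℓ)`. [cite: Derosa2018, §5.2 Prop. 5.4 (5.23) (proof, (5.29))] -/
theorem fracPotential_level {α : ℝ≥0} (hα : 0 < α) (hα1 : α < 1)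
    (N : ℕ) {CΦ : ℝ} (hCΦ : 0 ≤ CΦ) :
    ∃ c : ℝ, 0 < c ∧ ∃ C : ℝ, 0 ≤ C ∧ ∀ {a b : ℝ} (_ : a < b)
      {vℓ v : ℝ → UnitAddTorus (Fin 3) → EuclideanSpace ℝ (Fin 3)} {pℓ p : ℝ → UnitAddTorus (Fin 3) → ℝ}
      {Rℓ : ℝ → UnitAddTorus (Fin 3) → Fin 3 → EuclideanSpace ℝ (Fin 3)} {γ ν : ℝ} (_ : 0 ≤ ν) (_ : 0 < γ) (_ : γ < 1)
      (_ : Torus.IsFracNSReynoldsOn (Icc a b) γ ν vℓ pℓ Rℓ) (_ : Torus.IsFracNSReynoldsOn (Icc a b) γ ν v p (fun _ _ _ => 0))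
      (_ : v a = vℓ a) {U Λ E : ℝ} (_ : 0 < U) (_ : 1 ≤ Λ) (_ : 0 ≤ E)
      (_ : ∀ s ∈ Icc a b, ∀ m, 1 ≤ m → m ≤ N + 1 →
        Torus.eContDiffHolderNorm m α (vℓ s) ≤ ENNReal.ofReal (U * Λ ^ (m - 1)))
      (_ : ∀ s ∈ Icc a b, ∀ m, 1 ≤ m → m ≤ N + 1 →
        Torus.eContDiffHolderNorm m α (v s) ≤ ENNReal.ofReal (U * Λ ^ (m - 1)))
      (_ : ∀ s ∈ Icc a b, Torus.eContDiffHolderNorm N α (Rℓ s) ≤ ENNReal.ofReal (E * Λ ^ N))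
      (_ : ∀ s ∈ Icc a b, ∀ m, m < N →
        Torus.eContDiffHolderNorm m α (BDSV.biotSavart (fun y => v s y - vℓ s y)) ≤ ENNReal.ofReal (CΦ * (b - a) * E * Λ ^ m))
      (_ : (b - a) * U ≤ c),
      ∀ s ∈ Icc a b, Torus.eContDiffHolderNorm N α (BDSV.biotSavart (fun y => v s y - vℓ s y)) ≤
        ENNReal.ofReal (C * (b - a) * E * Λ ^ N) := by
  obtain ⟨A, hA1, hTN⟩ := Torus.eContDiffHolderNorm_fracTransport_higher (d := Fin 3) N
  obtain ⟨CF, hCF⟩ := holderCZBound_holds.fracPotential_rhs_le hα hα1 N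
  have hA0 : 0 < A := by linarith
  obtain ⟨P₂, hP₂def⟩ : ∃ P₂ : ℝ, P₂ = 2 * 3 ^ N * CF * (N + 1) := ⟨_, rfl⟩
  have hP₂0 : 0 ≤ P₂ := by rw [hP₂def]; positivity
  obtain ⟨P₁, hP₁def⟩ : ∃ P₁ : ℝ, P₁ = P₂ * (N * CΦ) + CF + N * CΦ := ⟨_, rfl⟩
  have hP₁0 : 0 ≤ P₁ := by rw [hP₁def]; positivity
  have hden : 0 < 2 * A * P₂ + 1 := by positivity
  obtain ⟨c, hcdef⟩ : ∃ c : ℝ, c = min (1 / 2) (min (1 / A) (1 / (2 * A * P₂ + 1))) := ⟨_, rfl⟩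
  have hc0 : 0 < c := by rw [hcdef]; exact lt_min (by norm_num) (lt_min (by positivity) (one_div_pos.2 hden))
  have hc1 : c ≤ 1 / 2 := by rw [hcdef]; exact min_le_left _ _
  have hc2 : c ≤ 1 / A := by rw [hcdef]; exact (min_le_right _ _).trans (min_le_left _ _)
  have hc3 : c ≤ 1 / (2 * A * P₂ + 1) := by rw [hcdef]; exact (min_le_right _ _).trans (min_le_right _ _)
  have hcle1 : c ≤ 1 := hc1.trans (by norm_num)
  refine ⟨c, hc0, 2 * A * P₁, by positivity, ?_⟩
  intro a b hab vℓ v pℓ p Rℓ γ ν hν hγ0 hγ1 hℓ hv hanchor U Λ E hU hΛ hE hvℓ hvv hR hΦ hc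
  have ht₀ : a ∈ Icc a b := left_mem_Icc.2 hab.le
  have hL : 0 < b - a := sub_pos.2 hab
  set L := b - a with hLdef
  have hLU : L * U ≤ c := hc
  have hLU1 : L * U ≤ 1 := hLU.trans hcle1
  have hU0 : 0 ≤ U := hU.le
  have hΛ0 : 0 ≤ Λ := zero_le_one.trans hΛ
  have hUJ : UniqueDiffOn ℝ (Icc a b) := uniqueDiffOn_Icc hab
  have hvs : ∀ s ∈ Icc a b, IsSmooth (v s) := fun s hs => hv.smooth_velocity.isSmooth_slice hs
  have hℓs : ∀ s ∈ Icc a b, IsSmooth (vℓ s) := fun s hs => hℓ.smooth_velocity.isSmooth_slice hs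
  have hRs : ∀ s ∈ Icc a b, IsSmooth (Rℓ s) := fun s hs => hℓ.smooth_stress.isSmooth_slice hs
  -- the transported field and its forcing
  set W : ℝ → UnitAddTorus (Fin 3) → EuclideanSpace ℝ (Fin 3) := fun t y => BDSV.biotSavart (fun z => v t z - vℓ t z) y with hWdef
  have hWdef' : ∀ t, W t = BDSV.biotSavart (fun y => v t y - vℓ t y) := fun t => rfl
  have hW : FunctionSpaces.Torus.IsSmoothSpaceTimeOn (Icc a b) W := fracPotential_smooth_Z' hab hℓ hv hWdef'
  have hWs : ∀ s ∈ Icc a b, IsSmooth (W s) := fun s hs => hW.isSmooth_slice hs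
  set G : ℝ → UnitAddTorus (Fin 3) → EuclideanSpace ℝ (Fin 3) := fun s x =>
    -(BDSV.biotSavart (FunctionSpaces.Torus.convect (BDSV.curl (W s)) (v s)) x) - BDSV.biotSavart (Torus.tensorDivergence (Rℓ s)) x +
      BDSV.biotSavart (fun y => BDSV.curl (FunctionSpaces.Torus.convect (vℓ s) (W s)) y - FunctionSpaces.Torus.convect (vℓ s) (BDSV.curl (W s)) y) x +
      Torus.gradient (FunctionSpaces.Torus.invLaplacian (FunctionSpaces.Torus.divergence (FunctionSpaces.Torus.convect (W s) (vℓ s)))) x with hGdef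
  have hG : FunctionSpaces.Torus.IsSmoothSpaceTimeOn (Icc a b) G := fracPotential_smooth_rhs hab hℓ hv hWdef'
  have heq : ∀ s ∈ Icc a b, ∀ x, FunctionSpaces.Torus.timeDerivWithin (Icc a b) W s x + FunctionSpaces.Torus.convect (vℓ s) (W s) x +
      ν • Torus.fracLaplacian γ (W s) x = G s x :=
    fun s hs x => fracPotential_transport_eq' hab hγ0 hℓ hv hanchor hWdef' hs x
  -- finiteness and the supremum `M` of the level-`N` norms of `W`
  obtain ⟨Bfin, hBfin0, hBfin⟩ := BDSV.exists_forall_eContDiffHolderNorm_le_of_Icc hab N hα1.le hW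
  set S := ⨆ s ∈ Icc a b, Torus.eContDiffHolderNorm N α (W s) with hSdef
  have hSle : S ≤ ENNReal.ofReal Bfin := iSup₂_le fun s hs => hBfin s hs
  have hST : S ≠ ⊤ := ne_top_of_le_ne_top ENNReal.ofReal_ne_top hSle
  obtain ⟨M, hMdef⟩ : ∃ M : ℝ, M = S.toReal := ⟨_, rfl⟩
  have hM0 : 0 ≤ M := by rw [hMdef]; exact ENNReal.toReal_nonneg
  have hMS : ENNReal.ofReal M = S := by rw [hMdef, ENNReal.ofReal_toReal hST]
  have hWM : ∀ s ∈ Icc a b, Torus.eContDiffHolderNorm N α (W s) ≤ ENNReal.ofReal M := by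
    intro s hs
    rw [hMS]
    exact le_iSup₂ (f := fun s _ => Torus.eContDiffHolderNorm N α (W s)) s hs
  -- bounds on all the levels `≤ N` of `W` against the velocities
  obtain ⟨T, hTdef⟩ : ∃ T : ℝ, T = N * CΦ * E * Λ ^ N + U * M := ⟨_, rfl⟩
  have hT0 : 0 ≤ T := by rw [hTdef]; positivity
  have hWj : ∀ s ∈ Icc a b, ∀ j, j ≤ N →
      Torus.eContDiffHolderNorm j α (W s) * ENNReal.ofReal (U * Λ ^ (N - j)) ≤ ENNReal.ofReal T := by
    intro s hs j hj
    have hT2 : U * M ≤ T := by rw [hTdef]; exact le_add_of_nonneg_left (by positivity)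
    rcases Nat.lt_or_eq_of_le hj with hjN | hjeq
    · have hT1 : CΦ * E * Λ ^ N * (L * U) ≤ T := by
        rw [hTdef]
        have hNpos : 0 < N := lt_of_le_of_lt (Nat.zero_le j) hjN
        have hN1 : (1 : ℝ) ≤ N := by exact_mod_cast hNpos
        have hQ : 0 ≤ CΦ * E * Λ ^ N := by positivity
        have h1 : CΦ * E * Λ ^ N * (L * U) ≤ CΦ * E * Λ ^ N * 1 :=
          mul_le_mul_of_nonneg_left hLU1 hQ
        nlinarith [mul_nonneg hU0 hM0]
      calc _ ≤ ENNReal.ofReal (CΦ * L * E * Λ ^ j) * ENNReal.ofReal (U * Λ ^ (N - j)) :=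
            mul_le_mul' (hΦ s hs j hjN) le_rfl
        _ = ENNReal.ofReal (CΦ * E * Λ ^ N * (L * U)) := by
            rw [← ENNReal.ofReal_mul (by positivity)]
            congr 1
            have hpow : Λ ^ j * Λ ^ (N - j) = Λ ^ N := by rw [← pow_add]; congr 1; omega
            calc CΦ * L * E * Λ ^ j * (U * Λ ^ (N - j)) = CΦ * E * (Λ ^ j * Λ ^ (N - j)) * (L * U) := by ring
              _ = _ := by rw [hpow]
        _ ≤ ENNReal.ofReal T := ENNReal.ofReal_le_ofReal hT1
    · rw [hjeq, Nat.sub_self, pow_zero, mul_one]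
      calc _ ≤ ENNReal.ofReal M * ENNReal.ofReal U := mul_le_mul' (hWM s hs) le_rfl
        _ = ENNReal.ofReal (U * M) := by rw [← ENNReal.ofReal_mul hM0]; congr 1; ring
        _ ≤ ENNReal.ofReal T := ENNReal.ofReal_le_ofReal hT2
  -- the bilinear sum of the forcing bound
  have hsum : ∀ s ∈ Icc a b, ∑ j ∈ Finset.range (N + 1), Torus.eContDiffHolderNorm j α (W s) *
      (Torus.eContDiffHolderNorm (N - j + 1) α (v s) + Torus.eContDiffHolderNorm (N - j + 1) α (vℓ s)) ≤
      ENNReal.ofReal ((N + 1) * (2 * T)) := by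
    intro s hs
    have hterm : ∀ j ∈ Finset.range (N + 1), Torus.eContDiffHolderNorm j α (W s) *
        (Torus.eContDiffHolderNorm (N - j + 1) α (v s) + Torus.eContDiffHolderNorm (N - j + 1) α (vℓ s)) ≤ ENNReal.ofReal (2 * T) := by
      intro j hj
      have hjN : j ≤ N := Nat.lt_succ_iff.1 (Finset.mem_range.1 hj)
      have hb : Torus.eContDiffHolderNorm (N - j + 1) α (v s) + Torus.eContDiffHolderNorm (N - j + 1) α (vℓ s) ≤
          ENNReal.ofReal (2 * (U * Λ ^ (N - j))) := by
        have h1 := hvv s hs (N - j + 1) (Nat.le_add_left 1 _) (by omega)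
        have h2 := hvℓ s hs (N - j + 1) (Nat.le_add_left 1 _) (by omega)
        rw [Nat.add_sub_cancel] at h1 h2
        rw [two_mul, ENNReal.ofReal_add (by positivity) (by positivity)]
        exact add_le_add h1 h2
      calc _ ≤ Torus.eContDiffHolderNorm j α (W s) * ENNReal.ofReal (2 * (U * Λ ^ (N - j))) := mul_le_mul' le_rfl hb
        _ = 2 * (Torus.eContDiffHolderNorm j α (W s) * ENNReal.ofReal (U * Λ ^ (N - j))) := by
            rw [ENNReal.ofReal_mul (by norm_num), ENNReal.ofReal_ofNat]; ring
        _ ≤ 2 * ENNReal.ofReal T := mul_le_mul' le_rfl (hWj s hs j hjN)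
        _ = ENNReal.ofReal (2 * T) := by rw [ENNReal.ofReal_mul (by norm_num : (0:ℝ) ≤ 2), ENNReal.ofReal_ofNat]
    calc _ ≤ ∑ _j ∈ Finset.range (N + 1), ENNReal.ofReal (2 * T) := Finset.sum_le_sum hterm
      _ = ENNReal.ofReal ((N + 1) * (2 * T)) := by
          rw [Finset.sum_const, Finset.card_range, nsmul_eq_mul, ENNReal.ofReal_mul (by positivity : (0 : ℝ) ≤ (N : ℝ) + 1),
            show ((N : ℝ) + 1) = ((N + 1 : ℕ) : ℝ) from (Nat.cast_add_one N).symm, ENNReal.ofReal_natCast]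
  -- the forcing bound
  obtain ⟨G₀, hG₀def⟩ : ∃ G₀ : ℝ, G₀ = CF * (3 ^ N * ((N + 1) * (2 * T)) + E * Λ ^ N) := ⟨_, rfl⟩
  have hG₀0 : 0 ≤ G₀ := by rw [hG₀def]; positivity
  have hGb : ∀ s ∈ Icc a b, Torus.eContDiffHolderNorm N α (G s) ≤ ENNReal.ofReal G₀ := by
    intro s hs
    have hws : IsSmooth (fun y => v s y - vℓ s y) := (hvs s hs).sub (hℓs s hs)
    have h := hCF (hWs s hs) (hℓs s hs) (hℓ.divFree s hs) (hvs s hs) (hRs s hs)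
    refine h.trans ?_
    rw [hG₀def, ENNReal.ofReal_mul (NNReal.coe_nonneg CF), ENNReal.ofReal_coe_nnreal,
      ENNReal.ofReal_add (by positivity) (by positivity), ENNReal.ofReal_mul (by positivity : (0 : ℝ) ≤ 3 ^ N),
      ENNReal.ofReal_pow (by norm_num : (0 : ℝ) ≤ 3), ENNReal.ofReal_ofNat]
    exact mul_le_mul' le_rfl (add_le_add (mul_le_mul' le_rfl (hsum s hs)) (hR s hs))
  -- the transport data
  have hK : ∀ s ∈ Icc a b, ∀ x, ‖Torus.fderiv (vℓ s) x‖ ≤ (⟨U, hU0⟩ : ℝ≥0) := by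
    intro s hs x
    have h := hvℓ s hs 1 le_rfl (Nat.le_add_left 1 N)
    rw [Nat.sub_self, pow_zero, mul_one] at h
    exact BDSV.norm_fderiv_le_of_eContDiffHolderNorm_one_le hU0 h x
  have hKL : ((⟨U, hU0⟩ : ℝ≥0) : ℝ) * (b - a) ≤ 1 / 2 := by
    change U * L ≤ 1 / 2
    rw [mul_comm]; exact hLU.trans hc1
  set V : ℕ → ℝ := fun j => U * Λ ^ (j - 1) with hVdef
  have hV0 : ∀ j, 0 ≤ V j := fun j => by positivity
  have hV : ∀ s ∈ Icc a b, ∀ j, 1 ≤ j → j ≤ N → Torus.eContDiffHolderNorm j α (vℓ s) ≤ ENNReal.ofReal (V j) :=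
    fun s hs j hj hjN => hvℓ s hs j hj (hjN.trans (Nat.le_succ N))
  have hsmall : (b - a) * V 1 * A ≤ 1 := by
    simp only [hVdef, Nat.sub_self, pow_zero, mul_one]
    calc L * U * A = A * (L * U) := by ring
      _ ≤ A * (1 / A) := mul_le_mul_of_nonneg_left (hLU.trans hc2) hA0.le
      _ = 1 := by field_simp
  set Φ : ℕ → ℝ := fun m => CΦ * L * E * Λ ^ m with hΦdef
  have hΦ0 : ∀ m, 0 ≤ Φ m := fun m => by positivity
  have hΦ' : ∀ s ∈ Icc a b, ∀ m, 1 ≤ m → m < N → Torus.eContDiffHolderNorm m α (W s) ≤ ENNReal.ofReal (Φ m) :=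
    fun s hs m _ hmN => hΦ s hs m hmN
  have hF₀ : Torus.eContDiffHolderNorm N α (W a) ≤ ENNReal.ofReal 0 := by
    have hW0 : W a = 0 := by
      have h0 : (fun z => v a z - vℓ a z) = 0 := by funext y; simp [hanchor]
      show (fun y => BDSV.biotSavart (fun z => v a z - vℓ a z) y) = 0
      rw [h0, BDSV.biotSavart_zero]
    rw [hW0, Torus.eContDiffHolderNorm_zero_fun]
    exact bot_le
  have hTN' := hTN hab hα1 hν hγ0 hγ1 hℓ.smooth_velocity hK hKL hV0 hV hsmall hW hG heq hΦ0 hΦ' le_rfl hG₀0 hF₀ hGb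
  -- the lower-order sum
  have hlow : ∑ i ∈ Finset.range (N - 1), V (i + 2) * Φ (N - 1 - i) ≤ (N - 1 : ℕ) * (CΦ * E * Λ ^ N) := by
    calc ∑ i ∈ Finset.range (N - 1), V (i + 2) * Φ (N - 1 - i) ≤ ∑ _i ∈ Finset.range (N - 1), CΦ * E * Λ ^ N := by
          refine Finset.sum_le_sum fun i hi => ?_
          have hiN : i < N - 1 := Finset.mem_range.1 hi
          simp only [hVdef, hΦdef]
          have hpow : Λ ^ (i + 2 - 1) * Λ ^ (N - 1 - i) = Λ ^ N := by rw [← pow_add]; congr 1; omega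
          calc U * Λ ^ (i + 2 - 1) * (CΦ * L * E * Λ ^ (N - 1 - i))
              = CΦ * E * (Λ ^ (i + 2 - 1) * Λ ^ (N - 1 - i)) * (L * U) := by ring
            _ = CΦ * E * Λ ^ N * (L * U) := by rw [hpow]
            _ ≤ CΦ * E * Λ ^ N * 1 := mul_le_mul_of_nonneg_left hLU1 (by positivity)
            _ = _ := mul_one _
      _ = (N - 1 : ℕ) * (CΦ * E * Λ ^ N) := by rw [Finset.sum_const, Finset.card_range, nsmul_eq_mul]
  -- absorb
  have hN1 : (0 : ℝ) ≤ ((N - 1 : ℕ) : ℝ) := Nat.cast_nonneg _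
  have hN1' : ((N - 1 : ℕ) : ℝ) ≤ N := by exact_mod_cast Nat.sub_le N 1
  obtain ⟨X, hXdef⟩ : ∃ X : ℝ, X = A * (0 + L * G₀ + L * ((N - 1 : ℕ) * (CΦ * E * Λ ^ N))) := ⟨_, rfl⟩
  have hX0 : 0 ≤ X := by rw [hXdef]; positivity
  have hWX : ∀ s ∈ Icc a b, Torus.eContDiffHolderNorm N α (W s) ≤ ENNReal.ofReal X := fun s hs => by
    rw [hXdef]
    exact (hTN' s hs).trans (ENNReal.ofReal_le_ofReal (mul_le_mul_of_nonneg_left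
      (add_le_add le_rfl (mul_le_mul_of_nonneg_left hlow hL.le)) hA0.le))
  have hMX : M ≤ X := by
    have h1 : S ≤ ENNReal.ofReal X := iSup₂_le fun s hs => hWX s hs
    rw [← hMS] at h1
    exact (ENNReal.ofReal_le_ofReal_iff hX0).1 h1
  -- `X = X' + θ M`, `θ ≤ 1/2`
  have hXsplit : X = A * L * (P₂ * (N * CΦ) + CF + (N - 1 : ℕ) * CΦ) * (E * Λ ^ N) +
      (A * (L * U) * P₂) * M := by
    rw [hXdef, hG₀def, hTdef, hP₂def]
    ring
  have hθ : A * (L * U) * P₂ ≤ 1 / 2 := by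
    have h2 : (A * P₂) * (1 / (2 * A * P₂ + 1)) ≤ 1 / 2 := by
      rw [mul_one_div, div_le_iff₀ hden]; linarith
    calc A * (L * U) * P₂ = (A * P₂) * (L * U) := by ring
      _ ≤ (A * P₂) * c := mul_le_mul_of_nonneg_left hLU (by positivity)
      _ ≤ (A * P₂) * (1 / (2 * A * P₂ + 1)) := mul_le_mul_of_nonneg_left hc3 (by positivity)
      _ ≤ 1 / 2 := h2
  have hcoef : P₂ * (N * CΦ) + CF + (N - 1 : ℕ) * CΦ ≤ P₁ := by
    rw [hP₁def]
    have : ((N - 1 : ℕ) : ℝ) * CΦ ≤ N * CΦ := mul_le_mul_of_nonneg_right hN1' hCΦ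
    linarith
  have hELN : 0 ≤ E * Λ ^ N := by positivity
  have hM2 : M ≤ 2 * A * P₁ * L * E * Λ ^ N := by
    have h4 : (A * (L * U) * P₂) * M ≤ (1 / 2) * M := mul_le_mul_of_nonneg_right hθ hM0
    have h5 : A * L * (P₂ * (N * CΦ) + CF + (N - 1 : ℕ) * CΦ) * (E * Λ ^ N) ≤ A * L * P₁ * (E * Λ ^ N) :=
      mul_le_mul_of_nonneg_right (mul_le_mul_of_nonneg_left hcoef (by positivity)) hELN
    have h1 : M ≤ A * L * P₁ * (E * Λ ^ N) + (1 / 2) * M :=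
      calc M ≤ X := hMX
        _ = _ := hXsplit
        _ ≤ A * L * P₁ * (E * Λ ^ N) + (1 / 2) * M := add_le_add h5 h4
    have h6 : M ≤ 2 * (A * L * P₁ * (E * Λ ^ N)) := by linarith
    calc M ≤ 2 * (A * L * P₁ * (E * Λ ^ N)) := h6
      _ = 2 * A * P₁ * L * E * Λ ^ N := by ring
  intro s hs
  exact (hWM s hs).trans (ENNReal.ofReal_le_ofReal hM2)

end Level

/-! ## Prop. 5.4: all levels, and (5.25′) -/

section AllLevels

/-- **De Rosa Prop. 5.4 (5.23), all levels `≤ N̄`, dimensionless form**: for `0 < α < 1` and `N̄`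
there are `c > 0`, `C ≥ 0` such that for `(v_ℓ, p_ℓ, R̊_ℓ)` fractional Navier–Stokes–Reynolds and
`(vᵢ, pᵢ)` exact fractional Navier–Stokes (`ν ≥ 0`, `0 < γ < 1`) on `[a,b] × T³` with `vᵢ(a) = v_ℓ(a)`,
`‖v_ℓ(s)‖_{m,α}, ‖vᵢ(s)‖_{m,α} ≤ U Λ^{m-1}` (`1 ≤ m ≤ N̄+1`), `‖R̊_ℓ(s)‖_{m,α} ≤ E Λ^m` (`m ≤ N̄`) and
`(b-a)U ≤ c`: `‖ℬ(vᵢ - v_ℓ)(s)‖_{N,α} ≤ C (b-a) E Λ^N` for `s ∈ [a,b]`, `N ≤ N̄`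
("`‖z̃ᵢ‖_{N+α} ≲ τ_qδ_{q+1}ℓ^{-N+α}`"). [cite: Derosa2018, §5.2 Prop. 5.4 (5.23)] -/
theorem fracPotential_zbound {α : ℝ≥0} (hα : 0 < α) (hα1 : α < 1) (Nbar : ℕ) :
    ∃ c : ℝ, 0 < c ∧ ∃ C : ℝ, 0 ≤ C ∧ ∀ {a b : ℝ} (_ : a < b)
      {vℓ v : ℝ → UnitAddTorus (Fin 3) → EuclideanSpace ℝ (Fin 3)} {pℓ p : ℝ → UnitAddTorus (Fin 3) → ℝ}
      {Rℓ : ℝ → UnitAddTorus (Fin 3) → Fin 3 → EuclideanSpace ℝ (Fin 3)} {γ ν : ℝ} (_ : 0 ≤ ν) (_ : 0 < γ) (_ : γ < 1)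
      (_ : Torus.IsFracNSReynoldsOn (Icc a b) γ ν vℓ pℓ Rℓ) (_ : Torus.IsFracNSReynoldsOn (Icc a b) γ ν v p (fun _ _ _ => 0))
      (_ : v a = vℓ a) {U Λ E : ℝ} (_ : 0 < U) (_ : 1 ≤ Λ) (_ : 0 ≤ E)
      (_ : ∀ s ∈ Icc a b, ∀ m, 1 ≤ m → m ≤ Nbar + 1 →
        Torus.eContDiffHolderNorm m α (vℓ s) ≤ ENNReal.ofReal (U * Λ ^ (m - 1)))
      (_ : ∀ s ∈ Icc a b, ∀ m, 1 ≤ m → m ≤ Nbar + 1 →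
        Torus.eContDiffHolderNorm m α (v s) ≤ ENNReal.ofReal (U * Λ ^ (m - 1)))
      (_ : ∀ s ∈ Icc a b, ∀ m, m ≤ Nbar →
        Torus.eContDiffHolderNorm m α (Rℓ s) ≤ ENNReal.ofReal (E * Λ ^ m))
      (_ : (b - a) * U ≤ c),
      ∀ s ∈ Icc a b, ∀ N, N ≤ Nbar → Torus.eContDiffHolderNorm N α (BDSV.biotSavart (fun y => v s y - vℓ s y)) ≤
        ENNReal.ofReal (C * (b - a) * E * Λ ^ N) := by
  induction Nbar with
  | zero =>
    obtain ⟨c, hc0, C, hC0, hlev⟩ := fracPotential_level hα hα1 0 (CΦ := 0) le_rfl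
    refine ⟨c, hc0, C, hC0, ?_⟩
    intro a b hab vℓ v pℓ p Rℓ γ ν hν hγ0 hγ1 hℓ hv hanchor U Λ E hU hΛ hE hvℓ hvv hR hc s hs N hN
    have hN0 : N = 0 := Nat.le_zero.1 hN
    subst hN0
    exact hlev hab hν hγ0 hγ1 hℓ hv hanchor hU hΛ hE hvℓ hvv (fun s hs => hR s hs 0 le_rfl)
      (fun s _ m hm => absurd hm (Nat.not_lt_zero m)) hc s hs
  | succ Nbar IH =>
    obtain ⟨c, hc0, C, hC0, hIH⟩ := IH
    obtain ⟨c₁, hc₁, C₁, hC₁0, hlev⟩ := fracPotential_level hα hα1 (Nbar + 1) (CΦ := C) hC0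
    refine ⟨min c c₁, lt_min hc0 hc₁, max C C₁, hC0.trans (le_max_left _ _), ?_⟩
    intro a b hab vℓ v pℓ p Rℓ γ ν hν hγ0 hγ1 hℓ hv hanchor U Λ E hU hΛ hE hvℓ hvv hR hc s hs N hN
    have hL : 0 ≤ b - a := (sub_pos.2 hab).le
    have hΛ0 : 0 ≤ Λ := zero_le_one.trans hΛ
    have hlow : ∀ s ∈ Icc a b, ∀ m, m ≤ Nbar → Torus.eContDiffHolderNorm m α (BDSV.biotSavart (fun y => v s y - vℓ s y)) ≤
        ENNReal.ofReal (C * (b - a) * E * Λ ^ m) :=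
      hIH hab hν hγ0 hγ1 hℓ hv hanchor hU hΛ hE (fun s hs m hm hmN => hvℓ s hs m hm (hmN.trans (Nat.le_succ _)))
        (fun s hs m hm hmN => hvv s hs m hm (hmN.trans (Nat.le_succ _)))
        (fun s hs m hmN => hR s hs m (hmN.trans (Nat.le_succ _))) (hc.trans (min_le_left _ _))
    rcases Nat.lt_or_eq_of_le hN with hNlt | hNeq
    · refine (hlow s hs N (Nat.lt_succ_iff.1 hNlt)).trans (ENNReal.ofReal_le_ofReal ?_)
      have : C ≤ max C C₁ := le_max_left _ _
      gcongr
    · rw [hNeq]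
      have h := hlev hab hν hγ0 hγ1 hℓ hv hanchor hU hΛ hE hvℓ hvv (fun s hs => hR s hs (Nbar + 1) le_rfl)
        (fun s hs m hm => hlow s hs m (Nat.lt_succ_iff.1 hm)) (hc.trans (min_le_right _ _)) s hs
      refine h.trans (ENNReal.ofReal_le_ofReal ?_)
      have : C₁ ≤ max C C₁ := le_max_right _ _
      gcongr

/-- **De Rosa Prop. 5.4 (5.25′), level `N`, given (5.23) up to level `N`** ("an obvious consequence
of (5.28)"): for `0 < α < 1`, `N` and the constant `CZ` of the potential bounds there is `C ≥ 0` with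
`‖(∂ₜ + v_ℓ·∇ + ν(-Δ)^γ)z̃(s)‖_{N,α} ≤ C E Λ^N` whenever `‖v_ℓ‖_{m,α}, ‖vᵢ‖_{m,α} ≤ UΛ^{m-1}`
(`1 ≤ m ≤ N+1`), `‖R̊_ℓ‖_{N,α} ≤ EΛ^N`, `‖z̃‖_{m,α} ≤ CZ (b-a) E Λ^m` (`m ≤ N`) and `(b-a)U ≤ 1`.
[cite: Derosa2018, §5.2 Prop. 5.4 (5.25′)] -/
theorem fracPotential_transport_le {α : ℝ≥0} (hα : 0 < α) (hα1 : α < 1) (N : ℕ) {CZ : ℝ} (hCZ : 0 ≤ CZ) :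
    ∃ C : ℝ, 0 ≤ C ∧ ∀ {a b : ℝ} (_ : a < b)
      {vℓ v : ℝ → UnitAddTorus (Fin 3) → EuclideanSpace ℝ (Fin 3)} {pℓ p : ℝ → UnitAddTorus (Fin 3) → ℝ}
      {Rℓ : ℝ → UnitAddTorus (Fin 3) → Fin 3 → EuclideanSpace ℝ (Fin 3)} {γ ν : ℝ} (_ : 0 < γ)
      (_ : Torus.IsFracNSReynoldsOn (Icc a b) γ ν vℓ pℓ Rℓ) (_ : Torus.IsFracNSReynoldsOn (Icc a b) γ ν v p (fun _ _ _ => 0))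
      (_ : v a = vℓ a) {U Λ E : ℝ} (_ : 0 < U) (_ : 1 ≤ Λ) (_ : 0 ≤ E)
      (_ : ∀ s ∈ Icc a b, ∀ m, 1 ≤ m → m ≤ N + 1 →
        Torus.eContDiffHolderNorm m α (vℓ s) ≤ ENNReal.ofReal (U * Λ ^ (m - 1)))
      (_ : ∀ s ∈ Icc a b, ∀ m, 1 ≤ m → m ≤ N + 1 →
        Torus.eContDiffHolderNorm m α (v s) ≤ ENNReal.ofReal (U * Λ ^ (m - 1)))
      (_ : ∀ s ∈ Icc a b, Torus.eContDiffHolderNorm N α (Rℓ s) ≤ ENNReal.ofReal (E * Λ ^ N))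
      (_ : ∀ s ∈ Icc a b, ∀ m, m ≤ N →
        Torus.eContDiffHolderNorm m α (BDSV.biotSavart (fun y => v s y - vℓ s y)) ≤ ENNReal.ofReal (CZ * (b - a) * E * Λ ^ m))
      (_ : (b - a) * U ≤ 1),
      ∀ s ∈ Icc a b, Torus.eContDiffHolderNorm N α (fun x =>
        FunctionSpaces.Torus.timeDerivWithin (Icc a b) (fun t y => BDSV.biotSavart (fun z => v t z - vℓ t z) y) s x +
          FunctionSpaces.Torus.convect (vℓ s) (BDSV.biotSavart (fun y => v s y - vℓ s y)) x +
          ν • Torus.fracLaplacian γ (BDSV.biotSavart (fun y => v s y - vℓ s y)) x) ≤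
        ENNReal.ofReal (C * E * Λ ^ N) := by
  obtain ⟨CF, hCF⟩ := holderCZBound_holds.fracPotential_rhs_le hα hα1 N
  refine ⟨CF * (3 ^ N * ((N + 1) * (2 * CZ)) + 1), by positivity, ?_⟩
  intro a b hab vℓ v pℓ p Rℓ γ ν hγ0 hℓ hv hanchor U Λ E hU hΛ hE hvℓ hvv hR hZ hLU1 s hs
  have hU0 : 0 ≤ U := hU.le
  have hΛ0 : 0 ≤ Λ := zero_le_one.trans hΛ
  have hL : 0 < b - a := sub_pos.2 hab
  set L := b - a with hLdef
  have hvs : IsSmooth (v s) := hv.smooth_velocity.isSmooth_slice hs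
  have hℓs : IsSmooth (vℓ s) := hℓ.smooth_velocity.isSmooth_slice hs
  have hRs : IsSmooth (Rℓ s) := hℓ.smooth_stress.isSmooth_slice hs
  set W : ℝ → UnitAddTorus (Fin 3) → EuclideanSpace ℝ (Fin 3) := fun t y => BDSV.biotSavart (fun z => v t z - vℓ t z) y with hWdef
  have hWdef' : ∀ t, W t = BDSV.biotSavart (fun y => v t y - vℓ t y) := fun t => rfl
  have hWs : IsSmooth (W s) := (fracPotential_smooth_Z' hab hℓ hv hWdef').isSmooth_slice hs
  have heq : (fun x => FunctionSpaces.Torus.timeDerivWithin (Icc a b) W s x + FunctionSpaces.Torus.convect (vℓ s) (W s) x +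
      ν • Torus.fracLaplacian γ (W s) x) = fun x =>
      -(BDSV.biotSavart (FunctionSpaces.Torus.convect (BDSV.curl (W s)) (v s)) x) - BDSV.biotSavart (Torus.tensorDivergence (Rℓ s)) x +
        BDSV.biotSavart (fun y => BDSV.curl (FunctionSpaces.Torus.convect (vℓ s) (W s)) y - FunctionSpaces.Torus.convect (vℓ s) (BDSV.curl (W s)) y) x +
        Torus.gradient (FunctionSpaces.Torus.invLaplacian (FunctionSpaces.Torus.divergence (FunctionSpaces.Torus.convect (W s) (vℓ s)))) x :=
    funext fun x => fracPotential_transport_eq' hab hγ0 hℓ hv hanchor hWdef' hs x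
  -- the bilinear sum
  have hsum : ∑ j ∈ Finset.range (N + 1), Torus.eContDiffHolderNorm j α (W s) *
      (Torus.eContDiffHolderNorm (N - j + 1) α (v s) + Torus.eContDiffHolderNorm (N - j + 1) α (vℓ s)) ≤
      ENNReal.ofReal ((N + 1) * (2 * CZ) * (E * Λ ^ N)) := by
    have hterm : ∀ j ∈ Finset.range (N + 1), Torus.eContDiffHolderNorm j α (W s) *
        (Torus.eContDiffHolderNorm (N - j + 1) α (v s) + Torus.eContDiffHolderNorm (N - j + 1) α (vℓ s)) ≤
        ENNReal.ofReal (2 * CZ * (E * Λ ^ N)) := by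
      intro j hj
      have hjN : j ≤ N := Nat.lt_succ_iff.1 (Finset.mem_range.1 hj)
      have hb : Torus.eContDiffHolderNorm (N - j + 1) α (v s) + Torus.eContDiffHolderNorm (N - j + 1) α (vℓ s) ≤
          ENNReal.ofReal (2 * (U * Λ ^ (N - j))) := by
        have h1 := hvv s hs (N - j + 1) (Nat.le_add_left 1 _) (by omega)
        have h2 := hvℓ s hs (N - j + 1) (Nat.le_add_left 1 _) (by omega)
        rw [Nat.add_sub_cancel] at h1 h2
        rw [two_mul, ENNReal.ofReal_add (by positivity) (by positivity)]
        exact add_le_add h1 h2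
      have hpow : Λ ^ j * Λ ^ (N - j) = Λ ^ N := by rw [← pow_add]; congr 1; omega
      have hreal : CZ * L * E * Λ ^ j * (2 * (U * Λ ^ (N - j))) ≤ 2 * CZ * (E * Λ ^ N) := by
        calc CZ * L * E * Λ ^ j * (2 * (U * Λ ^ (N - j))) = 2 * CZ * (E * (Λ ^ j * Λ ^ (N - j))) * (L * U) := by ring
          _ = 2 * CZ * (E * Λ ^ N) * (L * U) := by rw [hpow]
          _ ≤ 2 * CZ * (E * Λ ^ N) * 1 := mul_le_mul_of_nonneg_left hLU1 (by positivity)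
          _ = _ := mul_one _
      calc _ ≤ ENNReal.ofReal (CZ * L * E * Λ ^ j) * ENNReal.ofReal (2 * (U * Λ ^ (N - j))) := mul_le_mul' (hZ s hs j hjN) hb
        _ = ENNReal.ofReal (CZ * L * E * Λ ^ j * (2 * (U * Λ ^ (N - j)))) := by rw [← ENNReal.ofReal_mul (by positivity)]
        _ ≤ ENNReal.ofReal (2 * CZ * (E * Λ ^ N)) := ENNReal.ofReal_le_ofReal hreal
    calc _ ≤ ∑ _j ∈ Finset.range (N + 1), ENNReal.ofReal (2 * CZ * (E * Λ ^ N)) := Finset.sum_le_sum hterm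
      _ = ENNReal.ofReal ((N + 1) * (2 * CZ) * (E * Λ ^ N)) := by
          rw [Finset.sum_const, Finset.card_range, nsmul_eq_mul, show ((N : ℝ) + 1) * (2 * CZ) * (E * Λ ^ N) =
            ((N + 1 : ℕ) : ℝ) * (2 * CZ * (E * Λ ^ N)) by push_cast; ring,
            ENNReal.ofReal_mul (by positivity : (0 : ℝ) ≤ ((N + 1 : ℕ) : ℝ)), ENNReal.ofReal_natCast]
  rw [heq]
  refine (hCF hWs hℓs (hℓ.divFree s hs) hvs hRs).trans ?_
  rw [show CF * (3 ^ N * ((N + 1) * (2 * CZ)) + 1) * E * Λ ^ N = CF * (3 ^ N * ((N + 1) * (2 * CZ) * (E * Λ ^ N)) + E * Λ ^ N) by ring,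
    ENNReal.ofReal_mul (NNReal.coe_nonneg CF), ENNReal.ofReal_coe_nnreal,
    ENNReal.ofReal_add (by positivity) (by positivity), ENNReal.ofReal_mul (by positivity : (0 : ℝ) ≤ 3 ^ N),
    ENNReal.ofReal_pow (by norm_num : (0 : ℝ) ≤ 3), ENNReal.ofReal_ofNat]
  exact mul_le_mul' le_rfl (add_le_add (mul_le_mul' le_rfl hsum) (hR s hs))

/-- **De Rosa Prop. 5.4 ((5.23) and (5.25′)), dimensionless form, uniformly in the level `N ≤ N̄`**:
for `0 < α < 1` and `N̄` there are `c > 0`, `C ≥ 0` such that for `(v_ℓ, p_ℓ, R̊_ℓ)` fractional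
Navier–Stokes–Reynolds and `(vᵢ, pᵢ)` exact fractional Navier–Stokes (`ν ≥ 0`, `0 < γ < 1`) on
`[a,b] × T³` with `vᵢ(a) = v_ℓ(a)`, `‖v_ℓ(s)‖_{m,α}, ‖vᵢ(s)‖_{m,α} ≤ UΛ^{m-1}` (`1 ≤ m ≤ N̄+1`),
`‖R̊_ℓ(s)‖_{m,α} ≤ EΛ^m` (`m ≤ N̄`) and `(b-a)U ≤ c`, the potential `z̃ = ℬ(vᵢ - v_ℓ)` satisfies, for
`s ∈ [a,b]` and `N ≤ N̄`: `‖z̃(s)‖_{N,α} ≤ C(b-a)EΛ^N` and `‖(∂ₜ + v_ℓ·∇ + ν(-Δ)^γ)z̃(s)‖_{N,α} ≤ CEΛ^N`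
(with `b - a ≤ 2τ_q`, `Λ = ℓ⁻¹`, `E ≂ δ_{q+1}ℓ^α`, `U ≂ δ_q^{1/2}λ_qℓ^{-α}`: (5.23) and (5.25′)).
[cite: Derosa2018, §5.2 Prop. 5.4 (5.23), (5.25′)] -/
theorem fracPotentialStability {α : ℝ≥0} (hα : 0 < α) (hα1 : α < 1) (Nbar : ℕ) :
    ∃ c : ℝ, 0 < c ∧ ∃ C : ℝ, 0 ≤ C ∧ ∀ {a b : ℝ} (_ : a < b)
      {vℓ v : ℝ → UnitAddTorus (Fin 3) → EuclideanSpace ℝ (Fin 3)} {pℓ p : ℝ → UnitAddTorus (Fin 3) → ℝ}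
      {Rℓ : ℝ → UnitAddTorus (Fin 3) → Fin 3 → EuclideanSpace ℝ (Fin 3)} {γ ν : ℝ} (_ : 0 ≤ ν) (_ : 0 < γ) (_ : γ < 1)
      (_ : Torus.IsFracNSReynoldsOn (Icc a b) γ ν vℓ pℓ Rℓ) (_ : Torus.IsFracNSReynoldsOn (Icc a b) γ ν v p (fun _ _ _ => 0))
      (_ : v a = vℓ a) {U Λ E : ℝ} (_ : 0 < U) (_ : 1 ≤ Λ) (_ : 0 ≤ E)
      (_ : ∀ s ∈ Icc a b, ∀ m, 1 ≤ m → m ≤ Nbar + 1 →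
        Torus.eContDiffHolderNorm m α (vℓ s) ≤ ENNReal.ofReal (U * Λ ^ (m - 1)))
      (_ : ∀ s ∈ Icc a b, ∀ m, 1 ≤ m → m ≤ Nbar + 1 →
        Torus.eContDiffHolderNorm m α (v s) ≤ ENNReal.ofReal (U * Λ ^ (m - 1)))
      (_ : ∀ s ∈ Icc a b, ∀ m, m ≤ Nbar →
        Torus.eContDiffHolderNorm m α (Rℓ s) ≤ ENNReal.ofReal (E * Λ ^ m))
      (_ : (b - a) * U ≤ c),
      ∀ s ∈ Icc a b, ∀ N, N ≤ Nbar →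
        Torus.eContDiffHolderNorm N α (BDSV.biotSavart (fun y => v s y - vℓ s y)) ≤ ENNReal.ofReal (C * (b - a) * E * Λ ^ N) ∧
        Torus.eContDiffHolderNorm N α (fun x =>
          FunctionSpaces.Torus.timeDerivWithin (Icc a b) (fun t y => BDSV.biotSavart (fun z => v t z - vℓ t z) y) s x +
            FunctionSpaces.Torus.convect (vℓ s) (BDSV.biotSavart (fun y => v s y - vℓ s y)) x +
            ν • Torus.fracLaplacian γ (BDSV.biotSavart (fun y => v s y - vℓ s y)) x) ≤ ENNReal.ofReal (C * E * Λ ^ N) := by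
  obtain ⟨c, hc0, CZ, hCZ0, hZb⟩ := fracPotential_zbound hα hα1 Nbar
  -- the transport constants for all levels `≤ N̄`
  have hT : ∀ N, ∃ C : ℝ, 0 ≤ C ∧ _ := fun N => fracPotential_transport_le hα hα1 N hCZ0
  choose CT hCT0 hCT using hT
  obtain ⟨Cmax, hCmaxdef⟩ : ∃ Cmax : ℝ, Cmax = max CZ (∑ N ∈ Finset.range (Nbar + 1), CT N) := ⟨_, rfl⟩
  have hCTle : ∀ N, N ≤ Nbar → CT N ≤ Cmax := fun N hN => by
    rw [hCmaxdef]
    exact (Finset.single_le_sum (f := CT) (fun i _ => hCT0 i) (Finset.mem_range.2 (Nat.lt_succ_of_le hN))).trans (le_max_right _ _)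
  have hCZle : CZ ≤ Cmax := by rw [hCmaxdef]; exact le_max_left _ _
  refine ⟨min c 1, lt_min hc0 one_pos, Cmax, hCZ0.trans hCZle, ?_⟩
  intro a b hab vℓ v pℓ p Rℓ γ ν hν hγ0 hγ1 hℓ hv hanchor U Λ E hU hΛ hE hvℓ hvv hR hc s hs N hN
  have hL : 0 ≤ b - a := (sub_pos.2 hab).le
  have hΛ0 : 0 ≤ Λ := zero_le_one.trans hΛ
  have hz := hZb hab hν hγ0 hγ1 hℓ hv hanchor hU hΛ hE hvℓ hvv hR (hc.trans (min_le_left _ _))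
  refine ⟨(hz s hs N hN).trans (ENNReal.ofReal_le_ofReal ?_), ?_⟩
  · gcongr
  · have h := hCT N hab hγ0 hℓ hv hanchor hU hΛ hE (fun s hs m hm hmN => hvℓ s hs m hm (by omega))
      (fun s hs m hm hmN => hvv s hs m hm (by omega)) (fun s hs => hR s hs N hN)
      (fun s hs m hm => hz s hs m (hm.trans hN)) (hc.trans (min_le_right _ _)) s hs
    refine h.trans (ENNReal.ofReal_le_ofReal ?_)
    have : CT N ≤ Cmax := hCTle N hN
    gcongr

end AllLevels

end DeRosa

end Literature.Analysis.FluidPDE
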